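import Summits.BirchSwinnertonDyer.BirchSwinnertonDyer.Theorems.ErratumRoadFiveShimuraKolyvaginOrderBoundInertCarrierChoice
import HarnessLib

/-!
# Carrier port K4d for crux 19718 (`ShimuraKolyvaginOrderBoundInertFromFive`): choice independence of
# McCallum's class WITHOUT the unit hypothesis `d_K < −4`

Cell `bsd-stepL`, seat `shim-p1` (g8), item `stmt-BirchSwinnertonDyer-19718`, route `ErratumRoadFive` (K2).
Summit-side THEOREM-ONLY helper file (no definition, no named fact, no `sorry`), `--supports … --as helper`;
`K : Type`; `p`-generic.

HONEST FRAMING. p492461 (`…InertCarrierChoice`, K4b) compares the McCallum classes of two presentations of a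
Kolyvagin level through x11b3's abstract `KolyvaginChoice.exists_isCoprime_kolyvaginPoint_sub_smul_mem`, whose
hypothesis `orderOf σ_q = q + 1` holds at the prime levels `k = q` only when `𝒪_K^× = {±1}` (`d_K < −4`; x11b3
CYC-C). The crux 19718 does NOT exclude `d_K ∈ {−3, −4}`. This file removes the hypothesis: two generators of
the same cyclic group `G_q` with `σ^{q+1} = 1` differ by an exponent invertible MODULO `q + 1`
(`exists_pow_eq_of_zpowers_eq_of_pow_eq_one`: a unit of `ℤ/|G_q|` lifts to a unit of `ℤ/(q+1)`,
Mathlib `ZMod.unitsMap_surjective`), which is all Gross's rescaling argument uses (x11b3's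
`KolyvaginChoice.kolyvaginPoint_sub_smul_kolyvaginPoint_mem` takes `σ^{q+1} = 1`, not the order). The rest is
p492461 verbatim with `d_K < −4` replaced by `σ_q^{q+1} = 1` (a clause of the telescope data of p487239). The
printed input is the label (B4) in the weak form `Σ_{i ≤ q} σ^i y = a_q · y'`, hypothesis `hB4`, NOT discharged.
Nothing is discharged on the crux; S1 ∕ S2 untouched; nothing booked.

## What is proved (namespace `Summit.BirchSwinnertonDyer.BirchSwinnertonDyer.Theorems`)

* `exists_pow_eq_of_zpowers_eq_of_pow_eq_one` — `⟨σ'⟩ = ⟨σ⟩`, `σ^{ℓ+1} = 1`, `ℓ ≠ 0` ⟹ `σ' = σ^a` with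
  `a b ≡ 1 (mod ℓ+1)` for some `b`.
* `exists_isCoprime_kolyvaginPoint_sub_smul_mem_of_pow_eq_one` — x11b3's packaged rescaling
  `P' − u P ∈ nA`, `u` prime to `n`, under `σ_ℓ^{ℓ+1} = 1` instead of `orderOf σ_ℓ = ℓ + 1`.
* `exists_isCoprime_kolyvaginPoint_eq_of_presentations_of_pow_eq_one`,
  `zsmul_kolyvaginClass_mem_iff_of_presentations_of_pow_eq_one` — p492461's two theorems without `d_K < −4`.

References: [cite: GrossLMS1991, §3 "σ_ℓ a fixed generator of G_ℓ", (3.3), Prop. 3.6, §4 (4.1)]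
[cite: McCallumLMS1991, §4 (4)–(6), Prop. 4.4] [cite: BertoliniDarmon1996, §2.4]
-/

noncomputable section

open scoped Classical

set_option linter.dupNamespace false

namespace Summit.BirchSwinnertonDyer.BirchSwinnertonDyer.Theorems

open WeierstrassCurve Field NumberField IsDedekindDomain Finset
  Literature.NumberTheory.EllipticCurves Literature.NumberTheory.GaloisRepresentations
  Literature.NumberTheory.EllipticCurves.KolyvaginCocycle
  Literature.NumberTheory.EllipticCurves.KolyvaginEuler
  Literature.NumberTheory.EllipticCurves.RingClassField
  Literature.NumberTheory.EllipticCurves.ModularForms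
  Summit.BirchSwinnertonDyer.Rank1Residual.X11b

variable {K : Type} [Field K] [NumberField K] {W : WeierstrassCurve ℚ}

/-! ### §1 Two generators of `G_ℓ`, knowing only `σ^{ℓ+1} = 1` -/

/-- **Two generators of the same cyclic group differ by an exponent invertible mod `ℓ + 1`** when
`σ^{ℓ+1} = 1` (`ℓ ≠ 0`): `σ' = σ^a` with `a b ≡ 1 (mod ℓ + 1)`. If `d = |σ|` then `d ∣ ℓ + 1`, `σ' = σ^{a₀}`
with `a₀` a unit mod `d`, and a unit of `ℤ/d` lifts to a unit `a` of `ℤ/(ℓ+1)` (`ZMod.unitsMap_surjective`);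
`σ^a = σ^{a₀}`. Generalises x11b3's `KolyvaginChoice.exists_pow_eq_of_zpowers_eq` (which assumes `|σ| = ℓ + 1`).
[cite: GrossLMS1991, §3 (chunk 217 L1) "Let σ_ℓ be a fixed generator of G_ℓ"] -/
theorem exists_pow_eq_of_zpowers_eq_of_pow_eq_one {G : Type*} [Group G] {σ σ' : G} {ℓ : ℕ}
    (hℓ : ℓ ≠ 0) (hσ : σ ^ (ℓ + 1) = 1) (hz : Subgroup.zpowers σ' = Subgroup.zpowers σ) :
    ∃ a b : ℕ, σ' = σ ^ a ∧ a * b % (ℓ + 1) = 1 := by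
  have hfin : IsOfFinOrder σ := isOfFinOrder_iff_pow_eq_one.mpr ⟨ℓ + 1, Nat.succ_pos ℓ, hσ⟩
  have hdvd : orderOf σ ∣ ℓ + 1 := orderOf_dvd_of_pow_eq_one hσ
  -- `σ' = σ^{a₀}`, `σ = σ'^c`
  obtain ⟨a₀, ha₀⟩ : ∃ a₀ : ℕ, σ ^ a₀ = σ' :=
    (hfin.mem_powers_iff_mem_zpowers).mpr (by rw [← hz]; exact Subgroup.mem_zpowers σ')
  have hfin' : IsOfFinOrder σ' := by rw [← ha₀]; exact hfin.pow
  obtain ⟨c, hc⟩ : ∃ c : ℕ, σ' ^ c = σ :=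
    (hfin'.mem_powers_iff_mem_zpowers).mpr (by rw [hz]; exact Subgroup.mem_zpowers σ)
  -- `a₀ c ≡ 1 (mod |σ|)`, so `a₀` is a unit mod `|σ|`
  have hmod : a₀ * c ≡ 1 [MOD orderOf σ] := by
    rw [← pow_eq_pow_iff_modEq, pow_mul, ha₀, hc, pow_one]
  have hunit : IsUnit ((a₀ : ℕ) : ZMod (orderOf σ)) := by
    refine IsUnit.of_mul_eq_one ((c : ℕ) : ZMod (orderOf σ)) ?_
    rw [← Nat.cast_mul, (ZMod.natCast_eq_natCast_iff _ _ _).mpr hmod, Nat.cast_one]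
  have hcop : Nat.Coprime a₀ (orderOf σ) := (ZMod.isUnit_iff_coprime a₀ (orderOf σ)).mp hunit
  -- lift the unit to `ℤ/(ℓ+1)`
  haveI : NeZero (ℓ + 1) := ⟨Nat.succ_ne_zero ℓ⟩
  haveI : Fact (1 < ℓ + 1) := ⟨by omega⟩
  obtain ⟨u, hu⟩ := ZMod.unitsMap_surjective hdvd (ZMod.unitOfCoprime a₀ hcop)
  refine ⟨((u : (ZMod (ℓ + 1))ˣ) : ZMod (ℓ + 1)).val, ((u⁻¹ : (ZMod (ℓ + 1))ˣ) : ZMod (ℓ + 1)).val, ?_, ?_⟩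
  · -- `σ^a = σ^{a₀}` as `a ≡ a₀ (mod |σ|)`
    have hval : ((((u : (ZMod (ℓ + 1))ˣ) : ZMod (ℓ + 1)).val : ℕ) : ZMod (orderOf σ)) =
        ((a₀ : ℕ) : ZMod (orderOf σ)) := by
      have h := congrArg (fun x : (ZMod (orderOf σ))ˣ ↦ (x : ZMod (orderOf σ))) hu
      simp only [ZMod.unitsMap_val, ZMod.coe_unitOfCoprime] at h
      rw [← h, ZMod.cast_eq_val]
    rw [← ha₀, pow_eq_pow_iff_modEq]
    exact ((ZMod.natCast_eq_natCast_iff _ _ _).mp hval).symm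
  · rw [← ZMod.val_mul, Units.mul_inv, ZMod.val_one]

/-! ### §2 The rescaling package under `σ_ℓ^{ℓ+1} = 1` -/

/-- **`P'_L − u · P_L ∈ nA` with `u` prime to `n`** for two sections `f, f'` of `𝒢 → 𝒢/H` and two systems of
generators of the same cyclic groups `G_ℓ = ⟨σ_ℓ⟩ = ⟨σ'_ℓ⟩` with `σ_ℓ^{ℓ+1} = 1` (`ℓ ≠ 0`), under the
hypotheses of `KolyvaginEuler.smul_kolyvaginPoint_sub_mem` for `(σ, f)`. x11b3's
`KolyvaginChoice.exists_isCoprime_kolyvaginPoint_sub_smul_mem` with `orderOf σ_ℓ = ℓ + 1` weakened to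
`σ_ℓ^{ℓ+1} = 1` (§1); the algebra is x11b3's `kolyvaginPoint_sub_smul_kolyvaginPoint_mem` ∕ `isCoprime_prod_inv`.
[cite: GrossLMS1991, §4 (4.1) (chunk 218 L10)] [cite: McCallumLMS1991, §4 (4)] -/
theorem exists_isCoprime_kolyvaginPoint_sub_smul_mem_of_pow_eq_one
    {𝒢 : Type*} [CommGroup 𝒢] {A : Type*} [AddCommGroup A] [DistribMulAction 𝒢 A]
    {σ σ' : ℕ → 𝒢} {L : Finset ℕ} {n : ℤ}
    {H : Subgroup 𝒢} [Fintype (𝒢 ⧸ H)] {f f' : 𝒢 ⧸ H → 𝒢} (hf : ∀ q, (f q : 𝒢 ⧸ H) = q)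
    (hf' : ∀ q, (f' q : 𝒢 ⧸ H) = q) (hgen : H ≤ Subgroup.closure (σ '' (L : Set ℕ)))
    (hL : ∀ ℓ ∈ L, ℓ ≠ 0) (hord : ∀ ℓ ∈ L, σ ℓ ^ (ℓ + 1) = 1)
    (hz : ∀ ℓ ∈ L, Subgroup.zpowers (σ' ℓ) = Subgroup.zpowers (σ ℓ))
    (hdvd : ∀ ℓ ∈ L, n ∣ ((ℓ + 1 : ℕ) : ℤ)) {y : A}
    (htr : ∀ ℓ ∈ L, grAct A (traceElt (σ ℓ) ℓ) y ∈ zsmulRange A n) :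
    ∃ u : ℤ, IsCoprime u n ∧
      kolyvaginPoint σ' L f' y - u • kolyvaginPoint σ L f y ∈ zsmulRange A n := by
  have hab : ∀ ℓ, ∃ ab : ℕ × ℕ, ℓ ∈ L → σ' ℓ = σ ℓ ^ ab.1 ∧ ab.1 * ab.2 % (ℓ + 1) = 1 := by
    intro ℓ
    by_cases hℓ : ℓ ∈ L
    · obtain ⟨a, b, h1, h2⟩ := exists_pow_eq_of_zpowers_eq_of_pow_eq_one (hL ℓ hℓ) (hord ℓ hℓ) (hz ℓ hℓ)
      exact ⟨(a, b), fun _ ↦ ⟨h1, h2⟩⟩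
    · exact ⟨(0, 0), fun h ↦ (hℓ h).elim⟩
  choose ab hab using hab
  exact ⟨_, KolyvaginChoice.isCoprime_prod_inv (fun ℓ ↦ (ab ℓ).1) (fun ℓ ↦ (ab ℓ).2) hdvd
      (fun ℓ hℓ ↦ (hab ℓ hℓ).2),
    KolyvaginChoice.kolyvaginPoint_sub_smul_kolyvaginPoint_mem hf hf' hgen hord hdvd htr (fun ℓ ↦ (ab ℓ).1)
      (fun ℓ ↦ (ab ℓ).2) (fun ℓ hℓ ↦ (hab ℓ hℓ).1) (fun ℓ hℓ ↦ (hab ℓ hℓ).2)⟩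

/-! ### §3 Two presentations, without `d_K < −4` -/

/-- **Two presentations of the same Kolyvagin level give `P' = u • P + p^M • b` with `u` prime to `p`.**
Abstract datum: `𝒢` finite commutative acting on `A₀`, `ρ : 𝒢 → Aut_ℚ(K[k])` injective into `𝒢_k`,
`iA : A₀ ≃ E(K[k])` intertwining the actions; the level `k` square-free with every prime factor a
Kolyvagin prime of level `M`; the CM value `y ∈ A₀` with the trace label (B4) in the weak
form `Σ_{i ≤ q} σ^i y = a_q · y'` for every generator `σ` of `G_q`. Two presentations
`(σᵢ, Hᵢ, fᵢ, Sᵢ)` (`i = 1, 2`) as in the module docstring. Conclusion: `∃ u` prime to `p^M`, `∃ b ∈ A₀`,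
`P₂ = u • P₁ + p^M • b` for the Kolyvagin points `Pᵢ = Σ_{c ∈ 𝒢/Hᵢ} fᵢ(c) D_{σᵢ} y` — WITHOUT the
hypothesis `d_K < −4` of p492461 (`σ_q^{q+1} = 1` replaces `|σ_q| = q + 1`, see
`exists_pow_eq_of_zpowers_eq_of_pow_eq_one`). Proof: both
`Pᵢ` equal the Kolyvagin points of the CANONICAL subgroup `ρ⁻¹(G_k)` with sections valued in `Sᵢ`
(x11b3-p8's bridge `KolyvaginH37Bridge.map_kolyvaginPoint_eq_derivedPoint`: each is
`Σ_{s ∈ Sᵢ} s D y` in `E(K[k])`), then x11b3's abstract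
`KolyvaginChoice.kolyvaginPoint_sub_smul_kolyvaginPoint_mem` fed by K4a (`hgen`, `p^M ∣ a_q`),
`σ_q^{q+1} = 1`, (3.3) `p^M ∣ q + 1` and (B4). [cite: GrossLMS1991, §4 (4.1), Prop. 3.6,
§3 (3.3), Prop. 3.7 (1)] [cite: McCallumLMS1991, §4 (4)] -/
theorem exists_isCoprime_kolyvaginPoint_eq_of_presentations_of_pow_eq_one (hK : IsImaginaryQuadratic K)
    (ι : K →+* ℂ) {N : ℕ} [NeZero N] [W.IsElliptic] [W.IsGloballyMinimal]
    (Dt : ModularParametrizationData W N) {p M : ℕ} (hp : p.Prime) (hM : 1 ≤ M)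
    {k : ℕ} (hk : Squarefree k)
    (hkol : ∀ q ∈ k.primeFactors, IsKolyvaginPrime N W K p q ∧ FrobEqFrobInfty W K (p ^ M) q)
    {𝒢 : Type*} [CommGroup 𝒢] [Finite 𝒢] {A₀ : Type*} [AddCommGroup A₀] [DistribMulAction 𝒢 A₀]
    (ρ : 𝒢 →* (ringClassField K ι k ≃ₐ[ℚ] ringClassField K ι k)) (hρ : Function.Injective ρ)
    (h𝒢ρ : ∀ g : 𝒢, ρ g ∈ ringClassGal ι k)
    (iA : A₀ ≃+ (W.baseChange (ringClassField K ι k)).toAffine.Point)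
    (hiA : ∀ (g : 𝒢) (a : A₀), iA (g • a) = pointGalHom W (ringClassField K ι k) (ρ g) (iA a))
    (y : A₀)
    (hB4 : ∀ ℓ ∈ k.primeFactors, ∀ σ : ringClassField K ι k ≃ₐ[ℚ] ringClassField K ι k,
      Subgroup.zpowers σ = ringClassGalOver ι k (k / ℓ) →
      ∃ y' : (W.baseChange (ringClassField K ι k)).toAffine.Point,
        ∑ i ∈ Finset.range (ℓ + 1), pointGalHom W (ringClassField K ι k) (σ ^ i) (iA y) =
          W.frobeniusTrace ℓ • y')
    (σ₁ : ℕ → 𝒢) (H₁ : Subgroup 𝒢) [Fintype (𝒢 ⧸ H₁)] (f₁ : 𝒢 ⧸ H₁ → 𝒢)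
    (S₁ : Finset (ringClassField K ι k ≃ₐ[ℚ] ringClassField K ι k))
    (hH₁ : ∀ h ∈ H₁, ρ h ∈ ringClassGalOver ι k 1) (hf₁ : ∀ c, (f₁ c : 𝒢 ⧸ H₁) = c)
    (hf₁S : ∀ c, ρ (f₁ c) ∈ S₁) (hS₁sub : ∀ s ∈ S₁, s ∈ ringClassGal ι k)
    (hS₁ρ : (S₁ : Set (ringClassField K ι k ≃ₐ[ℚ] ringClassField K ι k)) ⊆ Set.range ρ)
    (hS₁tr : ∀ g ∈ ringClassGal ι k, ∃! s, s ∈ S₁ ∧ g⁻¹ * s ∈ ringClassGalOver ι k 1)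
    (hz₁ : ∀ q ∈ k.primeFactors, (Subgroup.zpowers (σ₁ q)).map ρ = ringClassGalOver ι k (k / q))
    (hord₁ : ∀ q ∈ k.primeFactors, σ₁ q ^ (q + 1) = 1)
    (σ₂ : ℕ → 𝒢) (H₂ : Subgroup 𝒢) [Fintype (𝒢 ⧸ H₂)] (f₂ : 𝒢 ⧸ H₂ → 𝒢)
    (S₂ : Finset (ringClassField K ι k ≃ₐ[ℚ] ringClassField K ι k))
    (hH₂ : ∀ h ∈ H₂, ρ h ∈ ringClassGalOver ι k 1) (hf₂ : ∀ c, (f₂ c : 𝒢 ⧸ H₂) = c)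
    (hf₂S : ∀ c, ρ (f₂ c) ∈ S₂) (hS₂sub : ∀ s ∈ S₂, s ∈ ringClassGal ι k)
    (hS₂ρ : (S₂ : Set (ringClassField K ι k ≃ₐ[ℚ] ringClassField K ι k)) ⊆ Set.range ρ)
    (hS₂tr : ∀ g ∈ ringClassGal ι k, ∃! s, s ∈ S₂ ∧ g⁻¹ * s ∈ ringClassGalOver ι k 1)
    (hz₂ : ∀ q ∈ k.primeFactors, (Subgroup.zpowers (σ₂ q)).map ρ = ringClassGalOver ι k (k / q)) :
    ∃ u : ℤ, IsCoprime u ((p ^ M : ℕ) : ℤ) ∧ ∃ b : A₀,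
      kolyvaginPoint σ₂ k.primeFactors f₂ y =
        u • kolyvaginPoint σ₁ k.primeFactors f₁ y + ((p ^ M : ℕ) : ℤ) • b := by
  -- the canonical subgroup `H_c = ρ⁻¹(G_k)` and sections valued in `S₁`, `S₂`
  set Hc : Subgroup 𝒢 := (ringClassGalOver ι k 1).comap ρ with hHc
  letI : Fintype (𝒢 ⧸ Hc) := Fintype.ofFinite _
  have hHc' : ∀ h ∈ Hc, ρ h ∈ ringClassGalOver ι k 1 := fun h hh ↦ Subgroup.mem_comap.mp hh
  obtain ⟨g₁, hg₁, hg₁S⟩ := exists_section_comap_of_transversal ι k ρ h𝒢ρ hS₁ρ hS₁tr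
  obtain ⟨g₂, hg₂, hg₂S⟩ := exists_section_comap_of_transversal ι k ρ h𝒢ρ hS₂ρ hS₂tr
  -- the four Kolyvagin points are the two derived points `Σ_{s ∈ Sᵢ} s D_{σᵢ} y` (x11b3-p8's bridge)
  have hbr : ∀ (σ : ℕ → 𝒢) (H : Subgroup 𝒢) [Fintype (𝒢 ⧸ H)] (f : 𝒢 ⧸ H → 𝒢)
      (S : Finset (ringClassField K ι k ≃ₐ[ℚ] ringClassField K ι k)),
      (∀ h ∈ H, ρ h ∈ ringClassGalOver ι k 1) → (∀ c, (f c : 𝒢 ⧸ H) = c) → (∀ c, ρ (f c) ∈ S) →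
      (∀ s ∈ S, s ∈ ringClassGal ι k) →
      ((S : Set (ringClassField K ι k ≃ₐ[ℚ] ringClassField K ι k)) ⊆ Set.range ρ) →
      (∀ g ∈ ringClassGal ι k, ∃! s, s ∈ S ∧ g⁻¹ * s ∈ ringClassGalOver ι k 1) →
      iA (kolyvaginPoint σ k.primeFactors f y) =
        KolyvaginOperator.derivedPoint (pointGalHom W (ringClassField K ι k)) (fun q ↦ ρ (σ q)) k S
          (iA y) := by
    intro σ H _ f S hH hf hfS hSsub hSρ hStr
    have hbij := KolyvaginH37Bridge.bijOn_of_section_of_transversal ρ hρ (H := H)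
      (Γ := ringClassGal ι k) (G₁ := ringClassGalOver ι k 1) hH
      (S := (↑S : Set (ringClassField K ι k ≃ₐ[ℚ] ringClassField K ι k)))
      (fun s hs ↦ hSsub s hs) hSρ (fun g hg ↦ hStr g hg) f hf hfS
    exact KolyvaginH37Bridge.map_kolyvaginPoint_eq_derivedPoint (pointGalHom W (ringClassField K ι k))
      ρ (iA : A₀ →+ (W.baseChange (ringClassField K ι k)).toAffine.Point) hiA hk
      (τ := fun q ↦ ρ (σ q)) (fun _ _ ↦ rfl) f hbij y
  have hP₁ : kolyvaginPoint σ₁ k.primeFactors f₁ y = kolyvaginPoint σ₁ k.primeFactors g₁ y :=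
    iA.injective (by rw [hbr σ₁ H₁ f₁ S₁ hH₁ hf₁ hf₁S hS₁sub hS₁ρ hS₁tr,
      hbr σ₁ Hc g₁ S₁ hHc' hg₁ hg₁S hS₁sub hS₁ρ hS₁tr])
  have hP₂ : kolyvaginPoint σ₂ k.primeFactors f₂ y = kolyvaginPoint σ₂ k.primeFactors g₂ y :=
    iA.injective (by rw [hbr σ₂ H₂ f₂ S₂ hH₂ hf₂ hf₂S hS₂sub hS₂ρ hS₂tr,
      hbr σ₂ Hc g₂ S₂ hHc' hg₂ hg₂S hS₂sub hS₂ρ hS₂tr])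
  -- the Euler hypotheses of the abstract core, for `(σ₁, H_c)`
  have hzz : ∀ (σ : ℕ → 𝒢), (∀ q ∈ k.primeFactors,
      (Subgroup.zpowers (σ q)).map ρ = ringClassGalOver ι k (k / q)) → ∀ q ∈ k.primeFactors,
      Subgroup.zpowers (ρ (σ q)) = ringClassGalOver ι k (k / q) := fun σ hz q hq ↦ by
    rw [← MonoidHom.map_zpowers]; exact hz q hq
  have hgen : Hc ≤ Subgroup.closure (σ₁ '' (k.primeFactors : Set ℕ)) :=
    le_closure_of_map_zpowers hK ι hk σ₁ Hc ρ hρ hz₁ hHc'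
  have hL : ∀ ℓ ∈ k.primeFactors, ℓ ≠ 0 := fun ℓ hℓ ↦ (Nat.prime_of_mem_primeFactors hℓ).ne_zero
  have hz : ∀ ℓ ∈ k.primeFactors, Subgroup.zpowers (σ₂ ℓ) = Subgroup.zpowers (σ₁ ℓ) :=
    fun ℓ hℓ ↦ Subgroup.map_injective hρ (by rw [hz₂ ℓ hℓ, hz₁ ℓ hℓ])
  have hdvd : ∀ ℓ ∈ k.primeFactors, ((p ^ M : ℕ) : ℤ) ∣ ((ℓ + 1 : ℕ) : ℤ) :=
    fun ℓ hℓ ↦ (IsKolyvaginPrime.pow_dvd_add_one W hp (hkol ℓ hℓ).1 hM (hkol ℓ hℓ).2).1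
  have htr : ∀ ℓ ∈ k.primeFactors,
      grAct A₀ (traceElt (σ₁ ℓ) ℓ) y ∈ zsmulRange A₀ ((p ^ M : ℕ) : ℤ) := by
    intro ℓ hℓ
    obtain ⟨y', hy'⟩ := hB4 ℓ hℓ (ρ (σ₁ ℓ)) (hzz σ₁ hz₁ ℓ hℓ)
    have haℓ := pow_dvd_frobeniusTrace_of_kolyvaginPrime (K := K) Dt hp hM (hkol ℓ hℓ).1 (hkol ℓ hℓ).2
    have hrel : grAct A₀ (traceElt (σ₁ ℓ) ℓ) y = W.frobeniusTrace ℓ • iA.symm y' := by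
      apply iA.injective
      rw [grAct_traceElt, map_sum, map_zsmul, AddEquiv.apply_symm_apply]
      simp_rw [hiA, map_pow ρ]
      exact hy'
    exact grAct_traceElt_mem_of_eq_smul hrel haℓ
  -- the abstract core (Gross §4: independence of `S`, generators up to scaling)
  obtain ⟨u, hu, hmem⟩ := exists_isCoprime_kolyvaginPoint_sub_smul_mem_of_pow_eq_one hg₁ hg₂ hgen
    hL hord₁ hz hdvd htr
  obtain ⟨b, hb⟩ := mem_zsmulRange_iff.mp hmem
  refine ⟨u, hu, b, ?_⟩
  rw [hP₁, hP₂, hb]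
  abel

/-! ### §4 Two presentations and two embeddings, without `d_K < −4` -/

/-- **THE CLASS COMPARISON for two presentations of the same Kolyvagin level** — the form in which
clause (f) of the `hpointsRk` binder of p482014 is insensitive to the auxiliary choices: with the data
of `exists_isCoprime_kolyvaginPoint_eq_of_presentations` for `𝒢` acting on `E(K[k])` ITSELF
(`g • a = ρ(g) a`), two embeddings `embᵢ : K[k] → K̄` that are the identity on `K`, `jᵢ = E(embᵢ)`,
the embedded modules `jᵢ(E(K[k]))` admissible for `p^M` and the embedded Kolyvagin points in
`invPoints`, one has `t • c_M(P₂) ∈ H ↔ t • c_M(P₁) ∈ H` for every subgroup `H ≤ H¹(K, E[p^M])` and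
every `t ∈ ℤ` — WITHOUT `d_K < −4` (twin of p492461's `zsmul_kolyvaginClass_mem_iff_of_presentations`
with `σ_q^{q+1} = 1` in place of `d_K < −4`). Proof: §3 (`P₂ = u P₁ + p^M b` in `E(K[k])`), the two embeddings differ by `γ ∈ Γ_K`
(x11b3 `KolyvaginChoice.exists_absGal_smul_eq`; K4a `smul_map_eq_map_of_smul_apply`,
`range_eq_of_smul_map_eq`), and K4a `zsmul_kolyvaginClass_mem_iff_of_eq_smul`. Port of x11b3's
`KolyvaginChoice.zsmul_kolyvaginClass_mem_iff` to bare data. [cite: GrossLMS1991, §4 (4.1), Lemma 4.3]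
[cite: McCallumLMS1991, §4 (4)–(6), Prop. 4.4] -/
theorem zsmul_kolyvaginClass_mem_iff_of_presentations_of_pow_eq_one (hK : IsImaginaryQuadratic K)
    (ι : K →+* ℂ) {N : ℕ} [NeZero N] [W.IsElliptic] [W.IsGloballyMinimal]
    (Dt : ModularParametrizationData W N) {p M : ℕ} (hp : p.Prime) (hM : 1 ≤ M)
    {k : ℕ} (hk : Squarefree k)
    (hkol : ∀ q ∈ k.primeFactors, IsKolyvaginPrime N W K p q ∧ FrobEqFrobInfty W K (p ^ M) q)
    (hdiv hdiv' : ∀ Q : geomPoints (W.baseChange K), ∃ R : geomPoints (W.baseChange K),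
      ((p ^ M : ℕ) : ℤ) • R = Q)
    {𝒢 : Type*} [CommGroup 𝒢] [Finite 𝒢]
    [DistribMulAction 𝒢 (W.baseChange (ringClassField K ι k)).toAffine.Point]
    (ρ : 𝒢 →* (ringClassField K ι k ≃ₐ[ℚ] ringClassField K ι k)) (hρ : Function.Injective ρ)
    (h𝒢ρ : ∀ g : 𝒢, ρ g ∈ ringClassGal ι k)
    (hact : ∀ (g : 𝒢) (a : (W.baseChange (ringClassField K ι k)).toAffine.Point),
      g • a = pointGalHom W (ringClassField K ι k) (ρ g) a)
    (y : (W.baseChange (ringClassField K ι k)).toAffine.Point)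
    (hB4 : ∀ ℓ ∈ k.primeFactors, ∀ σ : ringClassField K ι k ≃ₐ[ℚ] ringClassField K ι k,
      Subgroup.zpowers σ = ringClassGalOver ι k (k / ℓ) →
      ∃ y' : (W.baseChange (ringClassField K ι k)).toAffine.Point,
        ∑ i ∈ Finset.range (ℓ + 1), pointGalHom W (ringClassField K ι k) (σ ^ i) y =
          W.frobeniusTrace ℓ • y')
    (σ₁ : ℕ → 𝒢) (H₁ : Subgroup 𝒢) [Fintype (𝒢 ⧸ H₁)] (f₁ : 𝒢 ⧸ H₁ → 𝒢)
    (S₁ : Finset (ringClassField K ι k ≃ₐ[ℚ] ringClassField K ι k))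
    (hH₁ : ∀ h ∈ H₁, ρ h ∈ ringClassGalOver ι k 1) (hf₁ : ∀ c, (f₁ c : 𝒢 ⧸ H₁) = c)
    (hf₁S : ∀ c, ρ (f₁ c) ∈ S₁) (hS₁sub : ∀ s ∈ S₁, s ∈ ringClassGal ι k)
    (hS₁ρ : (S₁ : Set (ringClassField K ι k ≃ₐ[ℚ] ringClassField K ι k)) ⊆ Set.range ρ)
    (hS₁tr : ∀ g ∈ ringClassGal ι k, ∃! s, s ∈ S₁ ∧ g⁻¹ * s ∈ ringClassGalOver ι k 1)
    (hz₁ : ∀ q ∈ k.primeFactors, (Subgroup.zpowers (σ₁ q)).map ρ = ringClassGalOver ι k (k / q))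
    (hord₁ : ∀ q ∈ k.primeFactors, σ₁ q ^ (q + 1) = 1)
    (emb₁ : ringClassField K ι k →+* AlgebraicClosure K)
    (he₁ : ∀ x : K, emb₁ (algebraMap K (ringClassField K ι k) x) = algebraMap K (AlgebraicClosure K) x)
    (j₁ : (W.baseChange (ringClassField K ι k)).toAffine.Point →+ geomPoints (W.baseChange K))
    (hj₁ : j₁ = WeierstrassCurve.Affine.Point.map (W' := W) emb₁.toRatAlgHom)
    (hA₁ : IsAdmissible (absoluteGaloisGroup K) j₁.range ((p ^ M : ℕ) : ℤ))
    (hPt₁ : j₁ (kolyvaginPoint σ₁ k.primeFactors f₁ y) ∈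
      invPoints (absoluteGaloisGroup K) j₁.range ((p ^ M : ℕ) : ℤ))
    (σ₂ : ℕ → 𝒢) (H₂ : Subgroup 𝒢) [Fintype (𝒢 ⧸ H₂)] (f₂ : 𝒢 ⧸ H₂ → 𝒢)
    (S₂ : Finset (ringClassField K ι k ≃ₐ[ℚ] ringClassField K ι k))
    (hH₂ : ∀ h ∈ H₂, ρ h ∈ ringClassGalOver ι k 1) (hf₂ : ∀ c, (f₂ c : 𝒢 ⧸ H₂) = c)
    (hf₂S : ∀ c, ρ (f₂ c) ∈ S₂) (hS₂sub : ∀ s ∈ S₂, s ∈ ringClassGal ι k)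
    (hS₂ρ : (S₂ : Set (ringClassField K ι k ≃ₐ[ℚ] ringClassField K ι k)) ⊆ Set.range ρ)
    (hS₂tr : ∀ g ∈ ringClassGal ι k, ∃! s, s ∈ S₂ ∧ g⁻¹ * s ∈ ringClassGalOver ι k 1)
    (hz₂ : ∀ q ∈ k.primeFactors, (Subgroup.zpowers (σ₂ q)).map ρ = ringClassGalOver ι k (k / q))
    (emb₂ : ringClassField K ι k →+* AlgebraicClosure K)
    (he₂ : ∀ x : K, emb₂ (algebraMap K (ringClassField K ι k) x) = algebraMap K (AlgebraicClosure K) x)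
    (j₂ : (W.baseChange (ringClassField K ι k)).toAffine.Point →+ geomPoints (W.baseChange K))
    (hj₂ : j₂ = WeierstrassCurve.Affine.Point.map (W' := W) emb₂.toRatAlgHom)
    (hA₂ : IsAdmissible (absoluteGaloisGroup K) j₂.range ((p ^ M : ℕ) : ℤ))
    (hPt₂ : j₂ (kolyvaginPoint σ₂ k.primeFactors f₂ y) ∈
      invPoints (absoluteGaloisGroup K) j₂.range ((p ^ M : ℕ) : ℤ))
    (H : AddSubgroup (galH1Torsion (W.baseChange K) ((p ^ M : ℕ) : ℤ))) (t : ℤ) :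
    t • kolyvaginClass (W.baseChange K) _ hdiv' hA₂ (j₂ (kolyvaginPoint σ₂ k.primeFactors f₂ y))
        hPt₂ ∈ H ↔
      t • kolyvaginClass (W.baseChange K) _ hdiv hA₁ (j₁ (kolyvaginPoint σ₁ k.primeFactors f₁ y))
        hPt₁ ∈ H := by
  -- `P₂ = u P₁ + p^M b` in `E(K[k])`
  obtain ⟨u, hu, b, hb⟩ := exists_isCoprime_kolyvaginPoint_eq_of_presentations_of_pow_eq_one hK ι Dt hp
    hM hk hkol ρ hρ h𝒢ρ (AddEquiv.refl _) (fun g a ↦ hact g a) y hB4 σ₁ H₁ f₁ S₁ hH₁ hf₁ hf₁S hS₁sub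
    hS₁ρ hS₁tr hz₁ hord₁ σ₂ H₂ f₂ S₂ hH₂ hf₂ hf₂S hS₂sub hS₂ρ hS₂tr hz₂
  -- the two embeddings differ by `γ ∈ Γ_K`
  let e₁ : ringClassField K ι k →ₐ[K] AlgebraicClosure K := { emb₁ with commutes' := he₁ }
  let e₂ : ringClassField K ι k →ₐ[K] AlgebraicClosure K := { emb₂ with commutes' := he₂ }
  obtain ⟨γ, hγ⟩ := KolyvaginChoice.exists_absGal_smul_eq ι k e₁ e₂
  have hsm : ∀ P, γ • j₁ P = j₂ P :=
    smul_map_eq_map_of_smul_apply emb₁ emb₂ j₁ j₂ hj₁ hj₂ (fun x ↦ hγ x)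
  have hAeq : j₂.range = j₁.range :=
    range_eq_of_smul_map_eq j₁ j₂ hsm (fun g _ hx ↦ hA₁.smul_mem g hx) (fun g _ hx ↦ hA₂.smul_mem g hx)
  have hrel : j₂ (kolyvaginPoint σ₂ k.primeFactors f₂ y) =
      γ • (u • j₁ (kolyvaginPoint σ₁ k.primeFactors f₁ y) + ((p ^ M : ℕ) : ℤ) • j₁ b) := by
    rw [hb, ← hsm, map_add, map_zsmul, map_zsmul]
  exact zsmul_kolyvaginClass_mem_iff_of_eq_smul hA₁ hA₂ hAeq hPt₁ hPt₂ hu ⟨b, rfl⟩ γ hrel H t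

end Summit.BirchSwinnertonDyer.BirchSwinnertonDyer.Theorems

end
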